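import Mathlib
import HarnessLib
import Literature.Computability.AlgebraicComplexity.PatternExpressions
import Summits.ValiantsHypothesis.ValiantsHypothesis.Theorems.MonotoneRestorationOrbitCompressionQPNarrowClosure

/-!
# Route MonotoneRestoration — aside `OrbitCompressionQP` (stmt-ValiantsHypothesis-18332), line
# `expression_compression`: closure of «narrow of quasi-polynomial length» under QUASI-POLYNOMIALLY MANY
# summands, and the first generators beyond the sparse floors (power sums of row sums)

Continuation of `Theorems/…OrbitCompressionQPNarrowClosure.lean` (closure of the conclusion «NQP» of
`stub_narrowExpressionCompression` under scalars, binary sums and products):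

* `narrowQP_sum` — **quasi-polynomially many summands with one constant**: if `m n ≤ 2^{(log₂ n + c)^c}` and the
  families `g · i`, `i < m n`, are narrow of quasi-polynomial length UNIFORMLY (one constant for all `i`), then so
  is `n ↦ Σ_{i < m n} g n i` (pad every presentation to the common label counts `sup kᵢ, sup lᵢ` — still
  `n^{K+L} ≤ Q²` — rescale, big sum of `ShortClose.exists_close_eq_sum_smul`);
* `exists_value_eq_pow` — powers with length (`|e^j| = j(|e|+1)+1`);
* `narrowQP_rowSumPowerSum` — the GENERATORS `n ↦ Σ_i (Σ_j x_ij)^{m n}` (power sums of the row sums) for any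
  quasi-polynomially bounded exponent `m n` are narrow of quasi-polynomial length with ONE row and ONE column
  label (`(n²)⁻¹ · sumRow (sumCol edge)^{m}`, length `3 m n + 4`).  For `m n = n` this family has monomials on
  `n` columns and degree `n`: it lies OUTSIDE both floors of `Theorems/…OrbitCompressionQPCompressionFloors.lean`
  (not row/column-sparse, not of polylogarithmic degree) — the first landed members of NQP beyond the span
  machine, and the building blocks (with `narrowQP_add/mul/sum`) of the «one-row stratum» of the stub
  (symmetric `VP` polynomials of the row sums), whose completion needs the symmetric-reduction theorem of
  Bläser–Jindal (ITCS 2019, Thm 4) and formula balancing — recorded on the item, not used here.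

Helper file (`--supports stmt-ValiantsHypothesis-18332`); def-free; nothing here is a named fact; VP ≠ VNP is
not moved.
-/

noncomputable section

open MvPolynomial

-- `Summit.ValiantsHypothesis.ValiantsHypothesis.…` is the tree's single-conjunct layout (Sub = Summit).
set_option linter.dupNamespace false

namespace Summit.ValiantsHypothesis.ValiantsHypothesis.Theorems

namespace NarrowClosure

open Literature.Computability.AlgebraicComplexity

/-! ### Quasi-polynomially many summands -/

/-- **NQP is closed under quasi-polynomially many summands with one constant.** [folklore] -/
theorem narrowQP_sum (m : ℕ → ℕ) (g : (n : ℕ) → ℕ → MvPolynomial (Fin n × Fin n) ℂ)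
    (hm : ∃ c : ℕ, ∀ n : ℕ, m n ≤ 2 ^ ((Nat.log 2 n + c) ^ c))
    (hg : ∃ c : ℕ, ∀ n : ℕ, 1 ≤ n → ∀ i : ℕ, i < m n → ∃ (k l : ℕ) (e : PatternExpr ℂ k l),
      n ^ (k + l) ≤ 2 ^ ((Nat.log 2 n + c) ^ c) ∧ e.length ≤ 2 ^ ((Nat.log 2 n + c) ^ c) ∧
      e.close n = g n i) :
    ∃ c : ℕ, ∀ n : ℕ, 1 ≤ n → ∃ (k l : ℕ) (e : PatternExpr ℂ k l),
      n ^ (k + l) ≤ 2 ^ ((Nat.log 2 n + c) ^ c) ∧ e.length ≤ 2 ^ ((Nat.log 2 n + c) ^ c) ∧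
      e.close n = ∑ i ∈ Finset.range (m n), g n i := by
  classical
  obtain ⟨a, ha⟩ := hm
  obtain ⟨b, hb⟩ := hg
  obtain ⟨c₁, hc₁⟩ := qp_combine b b
  obtain ⟨c₂, hc₂⟩ := qp_combine a b
  obtain ⟨c₃, hc₃⟩ := qp_combine c₂ 0
  refine ⟨max c₁ c₃, fun n hn => ?_⟩
  have hn0 : 0 < n := hn
  have hmono₁ : 2 ^ ((Nat.log 2 n + c₁) ^ c₁) ≤ 2 ^ ((Nat.log 2 n + max c₁ c₃) ^ max c₁ c₃) :=
    Nat.pow_le_pow_right (by norm_num) (CompressionFloors.polylog_mono (le_max_left _ _))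
  have hmono₃ : 2 ^ ((Nat.log 2 n + c₃) ^ c₃) ≤ 2 ^ ((Nat.log 2 n + max c₁ c₃) ^ max c₁ c₃) :=
    Nat.pow_le_pow_right (by norm_num) (CompressionFloors.polylog_mono (le_max_right _ _))
  -- presentations of the summands, indexed by `Fin (m n)`
  choose k l e hkl hlen hclose using fun i : Fin (m n) => hb n hn i i.isLt
  -- common label counts
  set K : ℕ := Finset.univ.sup k with hK
  set L : ℕ := Finset.univ.sup l with hL
  have hkK : ∀ i, k i ≤ K := fun i => Finset.le_sup (f := k) (Finset.mem_univ i)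
  have hlL : ∀ i, l i ≤ L := fun i => Finset.le_sup (f := l) (Finset.mem_univ i)
  have hpad : ∀ i : Fin (m n), ∃ E : PatternExpr ℂ K L, E.length = (e i).length ∧
      E.close n = (n ^ (K - k i) * n ^ (L - l i)) • (e i).close n :=
    fun i => exists_close_eq_pad (hkK i) (hlL i) n (e i)
  choose E hE hEc using hpad
  have hNz : ∀ i : Fin (m n), (((n ^ (K - k i) * n ^ (L - l i) : ℕ)) : ℂ) ≠ 0 :=
    fun i => Nat.cast_ne_zero.2 (by positivity)
  obtain ⟨S, hS, hSlen⟩ := ShortClose.exists_close_eq_sum_smul Finset.univ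
    (fun i : Fin (m n) => ((((n ^ (K - k i) * n ^ (L - l i) : ℕ)) : ℂ))⁻¹) E n
  refine ⟨K, L, S, ?_, ?_, ?_⟩
  · -- labels
    rcases (Finset.univ : Finset (Fin (m n))).eq_empty_or_nonempty with h0 | hne
    · have hK0 : K = 0 := by rw [hK, h0, Finset.sup_empty, bot_eq_zero]
      have hL0 : L = 0 := by rw [hL, h0, Finset.sup_empty, bot_eq_zero]
      rw [hK0, hL0, add_zero, pow_zero]
      exact Nat.one_le_two_pow
    · obtain ⟨i₀, -, hi₀⟩ := Finset.exists_mem_eq_sup Finset.univ hne k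
      obtain ⟨i₁, -, hi₁⟩ := Finset.exists_mem_eq_sup Finset.univ hne l
      have hKL : K + L ≤ (k i₀ + l i₀) + (k i₁ + l i₁) := by rw [hK, hL, hi₀, hi₁]; omega
      calc n ^ (K + L) ≤ n ^ ((k i₀ + l i₀) + (k i₁ + l i₁)) := Nat.pow_le_pow_right hn0 hKL
        _ = n ^ (k i₀ + l i₀) * n ^ (k i₁ + l i₁) := pow_add _ _ _
        _ ≤ (n ^ (k i₀ + l i₀) + 2) * (n ^ (k i₁ + l i₁) + 2) := Nat.mul_le_mul (by omega) (by omega)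
        _ ≤ 2 ^ ((Nat.log 2 n + c₁) ^ c₁) := hc₁ _ _ _ (hkl i₀) (hkl i₁)
        _ ≤ _ := hmono₁
  · -- length `= Σ (|eᵢ| + 3) + 1 ≤ m (Q + 3) + 1 ≤ 2 (m+2)(Q+2) ≤ …`
    rw [hSlen]
    set Q : ℕ := 2 ^ ((Nat.log 2 n + b) ^ b) with hQ
    set Z : ℕ := (m n + 2) * (Q + 2) with hZ
    have hZ' : Z ≤ 2 ^ ((Nat.log 2 n + c₂) ^ c₂) := hc₂ _ _ _ (ha n) le_rfl
    calc ∑ i : Fin (m n), ((E i).length + 3) + 1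
        ≤ ∑ _i : Fin (m n), (Q + 3) + 1 := by
          refine Nat.add_le_add_right (Finset.sum_le_sum fun i _ => ?_) 1
          rw [hE]; exact Nat.add_le_add_right (hlen i) 3
      _ = m n * (Q + 3) + 1 := by simp
      _ ≤ (Z + 2) * (0 + 2) := by rw [hZ]; nlinarith
      _ ≤ 2 ^ ((Nat.log 2 n + c₃) ^ c₃) := hc₃ _ _ _ hZ' (Nat.zero_le _)
      _ ≤ _ := hmono₃
  · rw [hS, Finset.sum_range]
    refine Finset.sum_congr rfl fun i _ => ?_
    rw [hEc, hclose, ← Nat.cast_smul_eq_nsmul ℂ, smul_smul, inv_mul_cancel₀ (hNz i), one_smul]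

/-! ### Powers with length, and the power sums of the row sums -/

section Pow

variable {F : Type} [CommSemiring F] {k l : ℕ}

/-- **Powers with length**: `e^j` as the `j`-fold product, `|e^j| = j (|e| + 1) + 1`, value `(value e)^j`.
[folklore] -/
theorem exists_value_eq_pow (e : PatternExpr F k l) (j : ℕ) :
    ∃ e' : PatternExpr F k l, e'.length = j * (e.length + 1) + 1 ∧
      ∀ (n : ℕ) (ρ : Fin k → Fin n) (γ : Fin l → Fin n), e'.value n ρ γ = (e.value n ρ γ) ^ j := by
  induction j with
  | zero => exact ⟨PatternExpr.const 1, by simp [PatternExpr.length], fun n ρ γ => by simp⟩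
  | succ j ih =>
    obtain ⟨e', hlen, hv⟩ := ih
    refine ⟨PatternExpr.mul e e', ?_, fun n ρ γ => ?_⟩
    · rw [PatternExpr.length, hlen]; ring
    · rw [PatternExpr.value_mul, hv, pow_succ']

end Pow

/-- The closed polynomial of a `(1,1)`-expression whose value is constant is `n²` times that value. [folklore] -/
theorem close_eq_of_value_const {n : ℕ} (e : PatternExpr ℂ 1 1) (v : MvPolynomial (Fin n × Fin n) ℂ)
    (hv : ∀ (ρ : Fin 1 → Fin n) (γ : Fin 1 → Fin n), e.value n ρ γ = v) :
    e.close n = ((n * n : ℕ) : ℂ) • v := by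
  rw [PatternExpr.close]
  simp_rw [hv]
  simp only [Finset.sum_const, Finset.card_univ, Fintype.card_fun, Fintype.card_fin, pow_one, smul_smul]
  rw [← Nat.cast_smul_eq_nsmul ℂ]

/-- **Power sums of the row sums are narrow of quasi-polynomial length**: for every quasi-polynomially bounded
exponent `m n`, the family `n ↦ Σ_i (Σ_j x_ij)^{m n}` satisfies the conclusion of
`stub_narrowExpressionCompression` with one row and one column label and length `3 m n + 4`.  For `m n = n` this
family is outside both floors (degree `n`, monomials on up to `n` columns). [folklore] -/
theorem narrowQP_rowSumPowerSum (m : ℕ → ℕ) (hm : ∃ c : ℕ, ∀ n : ℕ, m n ≤ 2 ^ ((Nat.log 2 n + c) ^ c)) :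
    ∃ c : ℕ, ∀ n : ℕ, 1 ≤ n → ∃ (k l : ℕ) (e : PatternExpr ℂ k l),
      n ^ (k + l) ≤ 2 ^ ((Nat.log 2 n + c) ^ c) ∧ e.length ≤ 2 ^ ((Nat.log 2 n + c) ^ c) ∧
      e.close n = ∑ i : Fin n, (∑ j : Fin n, (X (i, j) : MvPolynomial (Fin n × Fin n) ℂ)) ^ (m n) := by
  obtain ⟨a, ha⟩ := hm
  obtain ⟨c₁, hc₁⟩ := CompressionFloors.labels_qp 1
  obtain ⟨c₂, hc₂⟩ := qp_combine a a
  refine ⟨max c₁ c₂, fun n hn => ?_⟩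
  -- the row sum at the row label, its power, and the sum over the row label
  set r : PatternExpr ℂ 1 1 := PatternExpr.sumCol 0 (PatternExpr.edge 0 0) with hr
  have hrv : ∀ (ρ : Fin 1 → Fin n) (γ : Fin 1 → Fin n),
      r.value n ρ γ = ∑ j : Fin n, (X (ρ 0, j) : MvPolynomial (Fin n × Fin n) ℂ) := by
    intro ρ γ
    simp [hr]
  obtain ⟨p, hplen, hpv⟩ := exists_value_eq_pow r (m n)
  set s : PatternExpr ℂ 1 1 := PatternExpr.sumRow 0 p with hs
  have hsv : ∀ (ρ : Fin 1 → Fin n) (γ : Fin 1 → Fin n),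
      s.value n ρ γ = ∑ i : Fin n, (∑ j : Fin n, (X (i, j) : MvPolynomial (Fin n × Fin n) ℂ)) ^ (m n) := by
    intro ρ γ
    simp only [hs, PatternExpr.value_sumRow, hpv, hrv, Function.update_self]
  have hn0 : ((n * n : ℕ) : ℂ) ≠ 0 := by
    have : 0 < n := hn
    exact Nat.cast_ne_zero.2 (by positivity)
  refine ⟨1, 1, PatternExpr.mul (PatternExpr.const (((n * n : ℕ) : ℂ))⁻¹) s, ?_, ?_, ?_⟩
  · exact (hc₁ n 1 (by rw [pow_one]; exact Nat.le_add_left 1 _)).trans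
      (Nat.pow_le_pow_right (by norm_num) (CompressionFloors.polylog_mono (le_max_left _ _)))
  · have hlen : (PatternExpr.mul (PatternExpr.const (((n * n : ℕ) : ℂ))⁻¹) s).length = 3 * m n + 4 := by
      simp only [PatternExpr.length, hs, hplen, hr]
      ring
    rw [hlen]
    calc 3 * m n + 4 ≤ (m n + 2) * (m n + 2) := by nlinarith
      _ ≤ 2 ^ ((Nat.log 2 n + c₂) ^ c₂) := hc₂ _ _ _ (ha n) (ha n)
      _ ≤ _ := Nat.pow_le_pow_right (by norm_num) (CompressionFloors.polylog_mono (le_max_right _ _))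
  · rw [ShortClose.close_const_mul, close_eq_of_value_const s _ hsv, smul_smul, inv_mul_cancel₀ hn0, one_smul]

end NarrowClosure

end Summit.ValiantsHypothesis.ValiantsHypothesis.Theorems

end
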